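import Summits.ResolutionOfSingularities.ResolutionOfSingularities.Theorems.FrobeniusClosingPatchingRelPerfectRoofEngineClosedStep
import Summits.ResolutionOfSingularities.ResolutionOfSingularities.Theorems.FrobeniusClosingPatchingRelPerfectRoofEngineNonClosedStep
import Literature.AlgebraicGeometry.Resolution.ExcellentRingsFieldProofs
import HarnessLib

/-!
# Crux `PatchingRelPerfect` (stmt-ResolutionOfSingularities-16161), line `closed-point-slice` v4:
# stub `stub_atomicRoofEngine`, part 1 — Temkin's step over any base and ONE ROOF PHASE

Route `ResolutionOfSingularities/FrobeniusClosing`, crux #6 `PatchingRelPerfect` (one term shared by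
eight routes). [OURS · L1 W5.2] This file and its sequel `…AtomicRoofEngine.lean` prove the registered stub
`stub_atomicRoofEngine` of skeleton v4 of the line `closed-point-slice`, verbatim: for ANY field `k`, an integral separated
`k`-scheme of finite type `M` every point `m` of which has a REGULAR ROOF — a proper birational
`k`-morphism `q : M → N` onto an integral finite-type `k`-scheme with `𝒪_{N,q m}` regular — whose
regular local rings carry LOCAL DESINGULARIZATIONS (every integral `T`, proper and birational over
`Spec 𝒪_{N,y}` and regular off the closed fibre, admits a blowing up with centre in `Sing T` and
regular source, Temkin 2008, Def. 2.2.6) has a resolution of singularities. This is the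
GLOBALISATION ("patching") half of Zariski's programme, as a theorem in every dimension; the local
half (the atoms) is what remains open in dimension `≥ 4`.

## Proof (this file: the first two items; the sequel: the third)

* `temkinStep_centre` — Temkin's step (proof of Prop. 2.3.4) over an ARBITRARY base `N` at a
  maximal point `y` of a closed `C ⊆ N` over which all singular points of `h : X₁ → N` lie: the
  local desingularization of `X₁ ×_N Spec 𝒪_{N,y}` extends (Lemma 2.1.1) to a blowing up of `X₁`
  whose CENTRE LIES IN `Sing X₁` and whose singular points lie over `C ∖ {y}`. (The landed
  `stub_roofEngineNonClosedStep` is this step; here the position of the centre is exported.)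
* `roofPhase` — for ONE roof `q : M → N` with local desingularizations over `Reg N` and a proper
  birational `f : X' → M`: a blowing up `X₁ → X'` with centre in `Sing X'` after which every
  singular point lies over `Sing N`. Well-founded induction on a closed `C ⊆ N` containing the
  images of the singular points that lie over `Reg N`; the step is taken at a maximal point of
  `C ∪ Sing N` above such an image, which is a regular point of `N` (the regular locus is open);
  the local scheme there is integral, proper, birational and regular off the closed fibre (by
  maximality), so the roof's atom applies.
* `stub_atomicRoofEngine` — finitely many roofs `q_m : M → N_m` with `⋃ q_m⁻¹(Reg N_m) = M` (`M`
  is quasi-compact, `Reg N_m` is open); induction on this finite set running one phase per roof on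
  the current model (centres in `Sing`, so what is regular stays regular and singular points keep
  singular images); at the end a singular point would lie over `Sing N_m` for every `m`,
  impossible; the composite is a blowing up of `M` along an ideal cosupported in `Sing M ∌ η_M`
  (Stacks 080B), hence a resolution.

## Sources

* M. Temkin, *Desingularization of quasi-excellent schemes in characteristic zero*, Adv. Math.
  219 (2008) 488–522 = arXiv:math/0703678: Lemma 2.1.1, Def. 2.2.6, Prop. 2.3.4 and its proof
  (p. 12, arXiv pagination). [Temkin2008]
* O. Piltant, *An axiomatic version of Zariski's patching theorem*, RACSAM 107 (2013) 91–121,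
  Prop. 5.1 and Cor. 5.7 (resolving systems, regular roofs). [Piltant2013]
* O. Zariski, *Reduction of the singularities of algebraic three dimensional varieties*, Ann. of
  Math. 45 (1944) 472–542, Fundamental Theorem p. 539. [Zariski1944]
* The Stacks Project, Tags 080A/080B (composition of blowing ups), 01J7. [StacksProject]
-/

set_option linter.dupNamespace false -- single-problem summit: doubled namespace component is forced

noncomputable section

open CategoryTheory CategoryTheory.Limits AlgebraicGeometry Literature.AlgebraicGeometry.Resolution
open TopologicalSpace IsLocalRing

namespace Summit.ResolutionOfSingularities.ResolutionOfSingularities.Theorems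

/-! ## Blowing ups with centre in the singular locus -/

/-- A blowing up whose centre lies in the singular locus maps singular points to singular points
(it is an isomorphism off the centre). [cite: Temkin2008, §2.2 (X_reg-admissible blow ups)] -/
theorem not_mem_regularLocus_of_isBlowup_of_support_subset {X₂ X₁ : Scheme.{0}}
    {f' : X₂ ⟶ X₁} {J' : X₁.IdealSheafData} (hf' : IsBlowup f' J')
    (hJ' : (J'.support : Set X₁) ⊆ (Scheme.regularLocus X₁)ᶜ) (x₂ : X₂)
    (hx₂ : x₂ ∉ Scheme.regularLocus X₂) : f' x₂ ∉ Scheme.regularLocus X₁ := by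
  intro hreg
  have h2 : f' x₂ ∉ (J'.support : Set X₁) := fun h => hJ' h hreg
  haveI := hf'.isIso_compl
  exact hx₂ ((mem_regularLocus_iff_of_isIso_morphismRestrict f'
    ⟨(J'.support : Set X₁)ᶜ, J'.support.isClosed.isOpen_compl⟩ x₂ h2).mpr hreg)

/-- A blowing up whose centre lies in the singular locus is an isomorphism over the regular locus:
a point over a regular point is regular. [cite: Temkin2008, §2.2] -/
theorem mem_regularLocus_of_isBlowup_of_support_subset {X₂ X₁ : Scheme.{0}}
    {f' : X₂ ⟶ X₁} {J' : X₁.IdealSheafData} (hf' : IsBlowup f' J')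
    (hJ' : (J'.support : Set X₁) ⊆ (Scheme.regularLocus X₁)ᶜ) (x₂ : X₂)
    (hx₁ : f' x₂ ∈ Scheme.regularLocus X₁) : x₂ ∈ Scheme.regularLocus X₂ := by
  by_contra h
  exact not_mem_regularLocus_of_isBlowup_of_support_subset hf' hJ' x₂ h hx₁

/-! ## Temkin's step over an arbitrary base, with the position of the centre -/

/-- **Temkin's step over the base `N`** (Temkin 2008, proof of Prop. 2.3.4, one step; cf. the
landed `stub_roofEngineNonClosedStep`, which is the same step without the statement about the
centre). Data: `N` integral of finite type over a field, `h : X₁ → N` proper, `X₁` regular over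
`N ∖ C` for a closed `C`, `y` a maximal point of `C`, and a desingularization `Bl_𝓘 S' → S'` of the
local scheme `S' = X₁ ×_N Spec 𝒪_{N,y}` (`𝓘` cosupported in `S'_sing`). Conclusion: a blowing up
`f' : X₂ → X₁` along the extension `𝓙` of `𝓘` (Lemma 2.1.1) — `Supp 𝓙` is the closure of the
image of `Supp 𝓘 ⊆ S'_sing = X₁_sing ∩ S'`, so `Supp 𝓙 ⊆ Sing X₁` (closed) — such that every
singular point of `X₂` lies over `C ∖ {y}`: off `C` because `f'` is an isomorphism off
`Supp 𝓙 ⊆ h⁻¹(C)` and `X₁` is regular there, not over `y` because `X₂ ×_{X₁} S' ≅ Bl_𝓘 S'` is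
regular (flat base change, uniqueness of blowing ups) and `X₂ ×_{X₁} S' → X₂` identifies local
rings. [cite: Temkin2008, Prop. 2.3.4 (proof, p. 12) and Lemma 2.1.1] -/
theorem temkinStep_centre {k : Type} [Field k] {N X₁ : Scheme.{0}}
    (gN : N ⟶ Spec (.of k)) [LocallyOfFiniteType gN] [QuasiCompact gN] [IsIntegral N]
    (h : X₁ ⟶ N) [IsProper h] (C : Set N) (hCcl : IsClosed C)
    (hreg : ∀ x : X₁, h x ∉ C → x ∈ Scheme.regularLocus X₁)
    (y : N) (hyC : y ∈ C) (hmax : ∀ y' ∈ C, y' ⤳ y → y' = y)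
    (hloc : Scheme.AdmitsDesingularization (pullback h (N.fromSpecStalk y))) :
    ∃ (X₂ : Scheme.{0}) (f' : X₂ ⟶ X₁) (J' : X₁.IdealSheafData), IsBlowup f' J' ∧
      (J'.support : Set X₁) ⊆ (Scheme.regularLocus X₁)ᶜ ∧
      ∀ x₂ : X₂, x₂ ∉ Scheme.regularLocus X₂ → h (f' x₂) ∈ C ∧ h (f' x₂) ≠ y := by
  -- adapted from `stub_roofEngineNonClosedStep` (= `temkin2008_prop234_of_comp`, one step)
  haveI : IsNoetherian N := Scheme.isNoetherian_of_finiteType_over_field gN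
  haveI : IsNoetherian X₁ := Scheme.isNoetherian_of_finiteType_over_field (h ≫ gN)
  have hk : Scheme.IsQuasiExcellent (Spec (.of k)) :=
    Scheme.isQuasiExcellent_of_locallyOfFiniteType Stacks07QW_field_holds (𝟙 _)
  have hsing₁ : IsClosed (Scheme.regularLocus X₁)ᶜ :=
    isClosed_compl_regularLocus_of_locallyOfFiniteType (h ≫ gN) hk
  -- the local scheme `S' = X₁ ×_N Spec 𝒪_{N,y}`, a pro-open pro-subscheme of `X₁`
  haveI : Flat (N.fromSpecStalk y) := flat_fromSpecStalk N y
  haveI : IsNoetherian (pullback h (N.fromSpecStalk y)) := {}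
  have hfj : ∀ s : ↑(pullback h (N.fromSpecStalk y)),
      h (pullback.fst h (N.fromSpecStalk y) s) =
        N.fromSpecStalk y (pullback.snd h (N.fromSpecStalk y) s) := fun s => by
    rw [← Scheme.Hom.comp_apply, pullback.condition, Scheme.Hom.comp_apply]
  -- `S'_sing ⊆ X₁_sing ∩ S'` lies over `y`: a singular point maps to a singular point of `X₁`,
  -- hence over `C`, over a generization of `y`, hence over `y` by maximality
  have hsing₀ : ∀ s : ↑(pullback h (N.fromSpecStalk y)),
      s ∉ Scheme.regularLocus (pullback h (N.fromSpecStalk y)) →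
        pullback.fst h (N.fromSpecStalk y) s ∉ Scheme.regularLocus X₁ := fun s hs hs' =>
    hs ((mem_regularLocus_iff_pullback_fst_fromSpecStalk h y s).mpr hs')
  have hsing : ∀ s : ↑(pullback h (N.fromSpecStalk y)),
      s ∉ Scheme.regularLocus (pullback h (N.fromSpecStalk y)) →
        pullback.snd h (N.fromSpecStalk y) s = closedPoint (N.presheaf.stalk y) := by
    intro s hs
    have h2 : h (pullback.fst h (N.fromSpecStalk y) s) ∈ C := by
      by_contra hc
      exact hsing₀ s hs (hreg _ hc)
    have h3 : N.fromSpecStalk y (pullback.snd h (N.fromSpecStalk y) s) ⤳ y :=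
      Scheme.range_fromSpecStalk.le ⟨_, rfl⟩
    have h4 : N.fromSpecStalk y (pullback.snd h (N.fromSpecStalk y) s) = y :=
      hmax _ (hfj s ▸ h2) h3
    apply (N.fromSpecStalk y).isEmbedding.injective
    rw [h4, Scheme.fromSpecStalk_closedPoint]
  -- the local desingularization
  obtain ⟨S'', g', hdes⟩ := hloc
  obtain ⟨I', hg', hI'⟩ := hdes.exists_isBlowup
  have hS''reg := hdes.isRegular
  -- extend its centre to `X₁` (Lemma 2.1.1) and blow `X₁` up along the extension
  obtain ⟨J', hJ'I', hJ'supp⟩ := exists_idealSheaf_extension_fromSpecStalk h y I'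
  obtain ⟨X₂, f', hf'⟩ := exists_isBlowup X₁ J'
  -- the new centre lies in `Sing X₁` …
  have hJ'sing : (J'.support : Set X₁) ⊆ (Scheme.regularLocus X₁)ᶜ := by
    rw [hJ'supp]
    refine hsing₁.closure_subset_iff.mpr ?_
    rintro _ ⟨s, hs, rfl⟩
    exact hsing₀ s (hI' hs)
  -- … and over `y`, inside `h⁻¹(C)`
  have hIy : ∀ s ∈ (I'.support : Set ↑(pullback h (N.fromSpecStalk y))),
      h (pullback.fst h (N.fromSpecStalk y) s) = y := fun s hs => by
    rw [hfj, hsing s (hI' hs), Scheme.fromSpecStalk_closedPoint]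
  have hJ'C : h '' (J'.support : Set X₁) ⊆ C := by
    rw [hJ'supp]
    refine (image_closure_subset_closure_image h.continuous).trans ?_
    refine hCcl.closure_subset_iff.mpr ?_
    rintro _ ⟨_, ⟨s, hs, rfl⟩, rfl⟩
    rw [hIy s hs]
    exact hyC
  refine ⟨X₂, f', J', hf', hJ'sing, fun x₂ hx₂ => ⟨?_, ?_⟩⟩
  · -- over `N ∖ C`: `X₁` is regular there and `f'` is an isomorphism off its centre
    by_contra hc
    exact not_mem_regularLocus_of_isBlowup_of_support_subset hf' hJ'sing x₂ hx₂ (hreg _ hc)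
  · -- over `y`: `X₂ ×_{X₁} S'` is the regular scheme `S''` (flat base change, uniqueness)
    intro hyx
    obtain ⟨s, hs⟩ := mem_range_pullback_fst_fromSpecStalk_of_eq h y hyx
    have hT' : IsBlowup (pullback.snd f' (pullback.fst h (N.fromSpecStalk y))) I' := by
      rw [← hJ'I']
      exact hf'.pullback_snd_of_flat _
    obtain ⟨e, -, -⟩ := hT'.unique hg'
    have hx₂range : x₂ ∈ Set.range (pullback.fst f' (pullback.fst h (N.fromSpecStalk y))) := by
      rw [Scheme.Pullback.range_fst]
      exact ⟨s, hs⟩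
    obtain ⟨t, rfl⟩ := hx₂range
    apply hx₂
    refine (mem_regularLocus_iff_of_flat_of_isPreimmersion _ t).mp ?_
    exact (mem_regularLocus_iff_of_flat_of_isPreimmersion e.hom t).mpr (hS''reg _)

/-! ## One phase: clearing the singular points over the regular locus of one roof -/

/-- **One phase of the engine.** Data: a roof `q : M → N` (proper birational, `M`, `N` integral of
finite type over the field `k`) whose regular local rings `𝒪_{N,y}` carry local desingularizations
(`hA`), and a proper birational `f : X' → M` with `X'` integral. Conclusion: a blowing up
`f₁ : X₁ → X'` with centre in `Sing X'` such that every singular point of `X₁` has a singular image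
in `X'` and lies over `Sing N`. PROOF: well-founded induction on a closed `C ⊆ N` such that every
singular point of the current model lying over `Reg N` lies over `C` (start `C = N`). If some
singular point lies over `Reg N`, its image `y₀ ∈ C ∩ Reg N` has a maximal point `y` of the closed
set `C ∪ Sing N` above it; `y ∈ Reg N` (the regular locus is open) and `y ∈ C`. The local scheme
`T = X₁ ×_N Spec 𝒪_{N,y}` is integral, proper and birational over `Spec 𝒪_{N,y}`
(`isIntegral_pullback_fromSpecStalk`, `isBirational_pullback_snd_fromSpecStalk`) and regular off
the closed fibre (a singular point of `T` is singular in `X₁`, so lies over `C ∪ Sing N`, over a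
generization of `y`, hence over `y`); `hA` desingularizes it and `temkinStep_centre` blows `X₁` up
with centre in `Sing X₁`, after which the singular points over `Reg N` lie over
`C' = C ∩ (image of the new singular locus) ∌ y`, `C' < C`. Centres in `Sing` compose
(Stacks 080B) and keep singular images singular. [cite: Temkin2008, Prop. 2.3.4 (proof);
Piltant2013, Prop. 5.1] -/
theorem roofPhase {k : Type} [Field k] {M N X' : Scheme.{0}}
    (gN : N ⟶ Spec (.of k)) [LocallyOfFiniteType gN] [QuasiCompact gN] [IsIntegral N]
    (q : M ⟶ N) [IsProper q] (hqbir : IsBirational q) [IsIntegral M]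
    (hA : ∀ y : N, IsRegularLocalRing (N.presheaf.stalk y) →
      ∀ (T : Scheme.{0}) (h : T ⟶ Spec (N.presheaf.stalk y)), IsIntegral T → IsProper h →
        IsBirational h →
        (∀ t : T, h.base t ≠ IsLocalRing.closedPoint (N.presheaf.stalk y) →
          IsRegularLocalRing (T.presheaf.stalk t)) →
        Scheme.AdmitsDesingularization T)
    (f : X' ⟶ M) [IsProper f] [IsIntegral X'] (hfbir : IsBirational f) :
    ∃ (X₁ : Scheme.{0}) (f₁ : X₁ ⟶ X') (J₁ : X'.IdealSheafData), IsBlowup f₁ J₁ ∧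
      (J₁.support : Set X') ⊆ (Scheme.regularLocus X')ᶜ ∧
      ∀ x₁ : X₁, x₁ ∉ Scheme.regularLocus X₁ →
        f₁ x₁ ∉ Scheme.regularLocus X' ∧ q (f (f₁ x₁)) ∉ Scheme.regularLocus N := by
  haveI : IsNoetherian N := Scheme.isNoetherian_of_finiteType_over_field gN
  haveI : IsNoetherian M := Scheme.isNoetherian_of_finiteType_over_field (q ≫ gN)
  haveI : IsNoetherian X' := Scheme.isNoetherian_of_finiteType_over_field ((f ≫ q) ≫ gN)
  have hk : Scheme.IsQuasiExcellent (Spec (.of k)) :=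
    Scheme.isQuasiExcellent_of_locallyOfFiniteType Stacks07QW_field_holds (𝟙 _)
  have hsingN : IsClosed (Scheme.regularLocus N)ᶜ :=
    isClosed_compl_regularLocus_of_locallyOfFiniteType gN hk
  have hηX' : genericPoint X' ∈ Scheme.regularLocus X' := genericPoint_mem_regularLocus X'
  -- the induction statement, on a closed `C ⊆ N` over which the singular points above `Reg N` lie
  suffices H : ∀ C : Closeds N,
      (∃ (X₁ : Scheme.{0}) (f₁ : X₁ ⟶ X') (J₁ : X'.IdealSheafData), IsBlowup f₁ J₁ ∧
        (J₁.support : Set X') ⊆ (Scheme.regularLocus X')ᶜ ∧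
        (∀ x₁ : X₁, x₁ ∉ Scheme.regularLocus X₁ → f₁ x₁ ∉ Scheme.regularLocus X') ∧
        ∀ x₁ : X₁, x₁ ∉ Scheme.regularLocus X₁ →
          q (f (f₁ x₁)) ∈ Scheme.regularLocus N → q (f (f₁ x₁)) ∈ (C : Set N)) →
      ∃ (X₁ : Scheme.{0}) (f₁ : X₁ ⟶ X') (J₁ : X'.IdealSheafData), IsBlowup f₁ J₁ ∧
        (J₁.support : Set X') ⊆ (Scheme.regularLocus X')ᶜ ∧
        ∀ x₁ : X₁, x₁ ∉ Scheme.regularLocus X₁ →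
          f₁ x₁ ∉ Scheme.regularLocus X' ∧ q (f (f₁ x₁)) ∉ Scheme.regularLocus N by
    refine H ⊤ ⟨X', 𝟙 X', ⊤, isBlowup_id_top X', ?_, fun x₁ hx₁ => ?_, fun x₁ _ _ => trivial⟩
    · simp [Scheme.IdealSheafData.support_top]
    · simpa using hx₁
  intro C
  induction C using WellFoundedLT.induction with
  | ind C ih =>
  intro ⟨X₁, f₁, J₁, hf₁, hJ₁, hss, hC⟩
  -- either every singular point already lies over `Sing N` …
  by_cases hdone : ∀ x₁ : X₁, x₁ ∉ Scheme.regularLocus X₁ →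
      q (f (f₁ x₁)) ∉ Scheme.regularLocus N
  · exact ⟨X₁, f₁, J₁, hf₁, hJ₁, fun x₁ hx₁ => ⟨hss x₁ hx₁, hdone x₁ hx₁⟩⟩
  -- … or some singular point `x₀` lies over `y₀ ∈ Reg N`, hence over `C`
  push Not at hdone
  obtain ⟨x₀, hx₀, hy₀reg⟩ := hdone
  have hy₀C : q (f (f₁ x₀)) ∈ (C : Set N) := hC x₀ hx₀ hy₀reg
  -- the closed set `C̃ = C ∪ Sing N` carries ALL singular points of `X₁`
  set Ct : Set N := (C : Set N) ∪ (Scheme.regularLocus N)ᶜ with hCt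
  have hCtcl : IsClosed Ct := C.isClosed.union hsingN
  -- the current model as an `N`-scheme
  have hne : J₁ ≠ ⊥ := by
    rintro rfl
    have : genericPoint X' ∈ ((⊥ : X'.IdealSheafData).support : Set X') := by
      rw [Scheme.IdealSheafData.support_bot]; trivial
    exact hJ₁ this hηX'
  haveI : IsIntegral X₁ := hf₁.isIntegral hne
  haveI : IsProper f₁ := hf₁.isProper
  haveI : IsNoetherian X₁ := Scheme.isNoetherian_of_finiteType_over_field (((f₁ ≫ f) ≫ q) ≫ gN)
  set h : X₁ ⟶ N := (f₁ ≫ f) ≫ q with hh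
  have happ : ∀ x₁ : X₁, h x₁ = q (f (f₁ x₁)) := fun x₁ => by
    simp only [hh, Scheme.Hom.comp_apply]
  have hbir : IsBirational h := ((hf₁.isBirational' hne).comp hfbir).comp hqbir
  have hregCt : ∀ x₁ : X₁, h x₁ ∉ Ct → x₁ ∈ Scheme.regularLocus X₁ := by
    intro x₁ hx₁
    by_contra hs
    apply hx₁
    rw [happ]
    by_cases hr : q (f (f₁ x₁)) ∈ Scheme.regularLocus N
    · exact Or.inl (hC x₁ hs hr)
    · exact Or.inr hr
  -- a maximal point `y` of `C̃` above `y₀`: a regular point of `N`, in `C`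
  obtain ⟨y, hyCt, hyy₀, hmax⟩ :=
    exists_maximal_point_specializes hCtcl (Or.inl hy₀C : q (f (f₁ x₀)) ∈ Ct)
  have hregNopen : IsOpen (Scheme.regularLocus N) := by
    rw [← compl_compl (Scheme.regularLocus N)]
    exact hsingN.isOpen_compl
  have hyreg : y ∈ Scheme.regularLocus N := hyy₀.mem_open hregNopen hy₀reg
  have hyC : y ∈ (C : Set N) := hyCt.resolve_right fun h' => h' hyreg
  -- the local scheme `T = X₁ ×_N Spec 𝒪_{N,y}`: integral, proper, birational, regular off the fibre
  haveI : Flat (N.fromSpecStalk y) := flat_fromSpecStalk N y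
  haveI : IsNoetherian (pullback h (N.fromSpecStalk y)) := {}
  have hTint : IsIntegral (pullback h (N.fromSpecStalk y)) :=
    isIntegral_pullback_fromSpecStalk h hbir y
  have hTbir : IsBirational (pullback.snd h (N.fromSpecStalk y)) :=
    isBirational_pullback_snd_fromSpecStalk h hbir y
  have hfj : ∀ s : ↑(pullback h (N.fromSpecStalk y)),
      h (pullback.fst h (N.fromSpecStalk y) s) =
        N.fromSpecStalk y (pullback.snd h (N.fromSpecStalk y) s) := fun s => by
    rw [← Scheme.Hom.comp_apply, pullback.condition, Scheme.Hom.comp_apply]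
  have hoff : ∀ t : ↑(pullback h (N.fromSpecStalk y)),
      pullback.snd h (N.fromSpecStalk y) t ≠ closedPoint (N.presheaf.stalk y) →
        IsRegularLocalRing ((pullback h (N.fromSpecStalk y)).presheaf.stalk t) := by
    intro t ht
    have h1 : N.fromSpecStalk y (pullback.snd h (N.fromSpecStalk y) t) ≠ y := fun e =>
      ht ((N.fromSpecStalk y).isEmbedding.injective
        (e.trans Scheme.fromSpecStalk_closedPoint.symm))
    have h2 : N.fromSpecStalk y (pullback.snd h (N.fromSpecStalk y) t) ⤳ y :=
      Scheme.range_fromSpecStalk.le ⟨_, rfl⟩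
    have h3 : h (pullback.fst h (N.fromSpecStalk y) t) ∉ Ct := fun hm =>
      h1 (hmax _ (hfj t ▸ hm) h2)
    exact (Scheme.mem_regularLocus _).mp
      ((mem_regularLocus_iff_pullback_fst_fromSpecStalk h y t).mpr (hregCt _ h3))
  -- the roof's atom at `y`, then Temkin's step over `N`
  have hloc : Scheme.AdmitsDesingularization (pullback h (N.fromSpecStalk y)) :=
    hA y ((Scheme.mem_regularLocus y).mp hyreg) _ (pullback.snd h (N.fromSpecStalk y)) hTint
      inferInstance hTbir hoff
  obtain ⟨X₂, f', J', hf', hJ'sing, hstep⟩ :=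
    temkinStep_centre gN h Ct hCtcl hregCt y hyCt hmax hloc
  -- compose: `X₂ → X₁ → X'` is a blowing up with centre in `Sing X'`
  obtain ⟨Q, hQ, hQsupp⟩ := hf₁.exists_isBlowup_comp hf'
  have hss' : ∀ x₂ : X₂, x₂ ∉ Scheme.regularLocus X₂ →
      (f' ≫ f₁) x₂ ∉ Scheme.regularLocus X' := fun x₂ hx₂ => by
    rw [Scheme.Hom.comp_apply]
    exact hss _ (not_mem_regularLocus_of_isBlowup_of_support_subset hf' hJ'sing x₂ hx₂)
  have hQsing : (Q.support : Set X') ⊆ (Scheme.regularLocus X')ᶜ := by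
    intro x hx
    rcases hQsupp hx with hx' | ⟨x₁, hx₁, rfl⟩
    · exact hJ₁ hx'
    · exact hss x₁ (hJ'sing hx₁)
  -- the new bad set `C' = C ∩ h(f'(Sing X₂))` is closed, misses `y`, and is smaller
  haveI : IsProper f' := hf'.isProper
  have hsing₂ : IsClosed (Scheme.regularLocus X₂)ᶜ :=
    isClosed_compl_regularLocus_of_locallyOfFiniteType ((f' ≫ h) ≫ gN) hk
  let C' : Closeds N :=
    ⟨(C : Set N) ∩ (f' ≫ h) '' (Scheme.regularLocus X₂)ᶜ,
      C.isClosed.inter ((f' ≫ h).isClosedMap _ hsing₂)⟩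
  have hC'C : (C' : Set N) ⊆ (C : Set N) := fun _ hz => hz.1
  have hyC' : y ∉ (C' : Set N) := by
    rintro ⟨-, x₂, hx₂, hx₂y⟩
    rw [Scheme.Hom.comp_apply] at hx₂y
    exact (hstep x₂ hx₂).2 hx₂y
  have hlt : C' < C := lt_of_le_of_ne hC'C fun e => hyC' (by rw [e]; exact hyC)
  refine ih C' hlt ⟨X₂, f' ≫ f₁, Q, hQ, hQsing, hss', fun x₂ hx₂ hr => ?_⟩
  have hx₂' : q (f ((f' ≫ f₁) x₂)) = h (f' x₂) := by
    rw [happ, Scheme.Hom.comp_apply]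
  rw [hx₂'] at hr ⊢
  refine ⟨?_, x₂, hx₂, by rw [Scheme.Hom.comp_apply]⟩
  have h1 : h (f' x₂) ∈ Ct := (hstep x₂ hx₂).1
  exact h1.resolve_right fun h' => h' hr

end Summit.ResolutionOfSingularities.ResolutionOfSingularities.Theorems

end
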